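import Mathlib
import Literature.NumberTheory.Automorphic.FuchsianEisensteinContinuation

/-!
# Meromorphic continuation of the Eisenstein series, III: the continuation to `ℂ` and the
continued series as automorphic eigenfunctions (Iwaniec, *Spectral Methods of Automorphic Forms*,
GSM 53, §6.2–6.3, Thm 6.5 context, (6.20)–(6.21); Thms 1.9, 1.16, Lemma 1.8; PDF pp. 21–24, 84–86)

Twenty-second brick of the general-`Γ` Eisenstein series, sixth file of **Chapter 6** (towards
`Iwaniec2002_eq_12_5` / `Iwaniec2002_thm_12_1` through `Fuchsian.SpectralParts`). The strips of
`FuchsianEisensteinContinuation` (kernels `RKernel.ofStrip N`, strips `⊇ {|Im s| < N + 1}`, normal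
forms `phiN`, `vN` independent of the kernel on overlaps) are patched, and the continued series is
realised as a genuine function on `ℍ`. Everything is PROVED; no fact is introduced.

1. (§1) `contScat i j : ℂ → ℂ` (**the continued scattering matrix `Φ(s) = (φᵢⱼ(s))`**) and
   `contEisH i : ℂ → L²_Y` (**the continued `[E^Y_𝔞ᵢ(·, s)]`**), through the kernel of the strip of
   `s` (`stripKernel s = ofStrip ⌊|Im s|⌋`); they coincide with `phiN κ`, `vN κ` on the strip of every
   resolvent kernel `κ`, are MEROMORPHIC IN NORMAL FORM ON `ℂ` (`meromorphicNFOn_contScat`,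
   `meromorphicNFOn_contEisH`), equal `eisScattering` / `[eisTrunc]` on `Re s > 1` and are analytic
   there; `IsEisRegular i s` (both analytic at `s`: the regular points, an open set containing
   `Re s > 1`); at a pole the value is `0`; and **the resolvent identity holds at every regular point
   for every Lipschitz test kernel** (`resolventIdentity_cont`).
2. (§2) the Laplacian kernel `bumpLap` of the bump kernels (Lemma 1.8): a Lipschitz test kernel with
   `ĥ_{k_Δ}(s) = -s(1-s) ĥ_k(s)` (`eigenvalueFn_bumpLap`, from `selbergTransform_kernelLaplacian`).
3. (§3) `contEisRep i s = Ẽᵢ(·, s) = [E^Y(s)]^Γ + θᵢ^s + Σⱼ φᵢⱼ(s) θⱼ^{1-s}` (automorphic, locally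
   integrable) and **`L_k Ẽᵢ(·, s) = ĥ_k(s) Ẽᵢ(·, s)` a.e. on `ℍ`** at regular `s` for every Lipschitz
   test kernel (`invariantOperator_contEisRep_ae_eq`: the `L²(F)` identity read on `ℍ` through the
   automorphic extension); `contEis i s z = E_𝔞ᵢ(z, s) := ĥ_k(s)⁻¹ (L_k Ẽᵢ(·, s))(z)`, `k` the kernel of
   the strip of `s` (Theorem 1.16: `E = ĥ⁻¹ L_k E`).
4. (§4) **At a regular point `E_𝔞ᵢ(·, s)` is a continuous automorphic `C²` solution of
   `(Δ + s(1-s))E = 0`** (`isC2_contEis_and_hypLaplacian`; Theorem 1.9 with the smooth strip kernel and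
   2), `= Ẽᵢ(·, s)` a.e., an eigenfunction of EVERY Lipschitz `L_k` with eigenvalue `ĥ_k(s)` pointwise
   (`invariantOperator_contEis`), independent of the kernel (`contEis_eq_invariantOperator`), and **for
   `Re s > 1` it is the Eisenstein series `E_𝔞ᵢ(z, s)` itself** (`contEis_eq_eisCusp`).
5. (§5) the bounded evaluation functional `Λ_{k,z} g = (T_k g)(z)` on `L²(F)` (`evalFunctional`) and
   **analyticity of `s ↦ E_𝔞ᵢ(z, s)` at every regular point** (`analyticAt_contEis_apply`).

## References
* [Iwaniec2002] H. Iwaniec, *Spectral Methods of Automorphic Forms*, 2nd ed., GSM 53, AMS 2002,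
  §6.2–6.3, Thm 6.5, (6.20)–(6.21), PDF pp. 84–86; Lemma 1.8, Thms 1.9 & 1.16, PDF pp. 21–24
  (held copy `book:iwaniec2002-spectral-methods-automorphic-forms`).
* [Colindeverdiere1983] Y. Colin de Verdière, *Pseudo-laplaciens II*, Ann. Inst. Fourier 33 (1983) 87–113.

Mathlib: `ContDiffBump.hasCompactSupport`, `HasCompactSupport.deriv`, `meromorphicNFAt_congr`,
`isOpen_analyticAt`, `LinearMap.mkContinuous`, `Finset.analyticAt_fun_sum`. Literature: `phiN`, `vN`,
`phiN_eqOn_inter`, `vN_eqOn_inter`, `residK_eq_zero`, `coe_vN_eq_eisTruncLp`, `phiN_eq_eisScattering`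
(`FuchsianEisensteinContinuation`); `RKernel.ofStrip`, `RKernel.mem_strip_ofStrip` (`ResolventKernels`);
`bumpKernel`, `stripSupport`, `eigenvalueFn` (`SelbergTransformStrip`); `kernelLaplacian`, `kernelLaplacian_eq_zero`,
`isC2_invariantOperator_and_hypLaplacian`, `selbergTransform_kernelLaplacian`, `hypLaplacian_const_mul'`
(`InvariantOperatorRegularity`); `lipschitzWith_of_hasCompactSupport_deriv`, `isOpenPosMeasure_volume`,
`eq_zero_of_continuous_of_ae_eq_zero`, `invariantOperator_congr_ae` (`MaassCuspForms`); `autExt`, `isAutomorphic_autExt`,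
`autExt_congr_ae`, `autExt_ae_eq_of_isAutomorphic`, `autExt_const_mul`, `locallyIntegrable_autExt`, `kernelOp_add`,
`kernelOp_smul`, `kernelOp_congr_ae`, `kernelOp_eq_invariantOperator`, `kernelCLM_coeFn` (`AutomorphicKernelOperators`,
`CuspidalSubspace`); `integral_norm_autExt_closedBall_le'`, `norm_eq_sqrt_lintegral'`, `orbitBoundAt`
(`FuchsianCuspFormsCompact`); `continuous_invariantOperator` (`CuspFormsCompact`); `tailEis`, `tailDefect`,
`tailDefectLp_coeFn`, `memLp_tailDefect`, `isAutomorphic_tailDefect`, `locallyIntegrable_tailEis`,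
`differentiable_invariantOperator_tailEis_apply`, `invariantOperator_add`, `invariantOperator_finset_sum`,
`eisCusp_eq_eisTrunc_add_tails`, `invariantOperator_eisCusp` (`FuchsianEisensteinTails`); `invariantOperator_const_mul`,
`invariantOperator_comp_smul_of_mem_range`, `norm_invariantOperator_le` (`InvariantIntegralOperators`).
-/

noncomputable section

namespace Literature.NumberTheory.Automorphic

open _root_.MeasureTheory _root_.Set _root_.Filter _root_.Real _root_.Topology _root_.Metric _root_.UpperHalfPlane
open _root_.Literature.Analysis.OperatorTheory.CompactResolvent
open scoped _root_.ENNReal _root_.NNReal _root_.MatrixGroups _root_.Pointwise _root_.InnerProductSpace _root_.Matrix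

namespace Fuchsian

variable {Γ : Subgroup (GL (Fin 2) ℝ)} {F : Set ℍ} {h : ℕ} {𝔞 : Fin h → OnePoint ℝ} {σ : Fin h → SL(2, ℝ)}

/-! ## 1. Patching the strips: the continuation to all of `ℂ` -/

section Patching

variable (hΓ : Γ ≤ (Matrix.SpecialLinearGroup.toGL : SL(2, ℝ) →* GL (Fin 2) ℝ).range)
  (hneg : (-1 : GL (Fin 2) ℝ) ∈ Γ) (hd : IsDiscreteSubgroup Γ) (hF : IsHypFundamentalDomain Γ F)
  (σ : Fin h → SL(2, ℝ)) (Y : ℝ)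

/-- The index of the strip used at `s`: `N(s) = ⌊|Im s|⌋`, so that `|Im s| < N(s) + 1`. [folklore] -/
def stripIndex (s : ℂ) : ℕ := ⌊|s.im|⌋₊

/-- The resolvent kernel used at `s`. [folklore] -/
abbrev stripKernel (s : ℂ) : RKernel := RKernel.ofStrip (stripIndex s)

/-- `s` lies in the strip of its kernel. [folklore] -/
theorem mem_strip_stripKernel (s : ℂ) : s ∈ (stripKernel s).strip :=
  RKernel.mem_strip_ofStrip (Nat.lt_floor_add_one _)

/-- **The meromorphically continued scattering matrix** `φᵢⱼ : ℂ → ℂ` (values `0` at the poles).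
[cite: Iwaniec2002, §6.2 (after (6.18)) & Thm 6.5 context, PDF pp. 85–86] -/
def contScat (i j : Fin h) (s : ℂ) : ℂ :=
  phiN hΓ hneg hd hF σ (stripKernel s) Y i j s

/-- **The meromorphically continued truncated Eisenstein series** `s ↦ [E^Y_𝔞ᵢ(·, s)] ∈ L²_Y`, on
all of `ℂ` (values `0` at the poles). [cite: Iwaniec2002, §6.2 Prop. 6.8 & (6.10)–(6.18), PDF pp. 84–85, 88] -/
def contEisH (i : Fin h) (s : ℂ) : pseudoCuspSubmodule hΓ hneg hd hF σ Y :=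
  vN hΓ hneg hd hF σ (stripKernel s) Y i s

/-- **Regular points**: `s` is a regular point of `E_𝔞ᵢ` if `[E^Y_𝔞ᵢ(·, s)]` and the row
`(φᵢⱼ(s))ⱼ` are analytic at `s`. [cite: Iwaniec2002, §6.3, PDF p. 86] -/
def IsEisRegular (i : Fin h) (s : ℂ) : Prop :=
  AnalyticAt ℂ (contEisH hΓ hneg hd hF σ Y i) s ∧ ∀ j, AnalyticAt ℂ (contScat hΓ hneg hd hF σ Y i j) s

variable {σ Y}
variable (hvol : volume F < ⊤)
  (hinfty : ∀ i, (Matrix.SpecialLinearGroup.toGL (σ i) : GL (Fin 2) ℝ) • (OnePoint.infty : OnePoint ℝ) = 𝔞 i)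
  (hper : ∀ i, (ConjAct.toConjAct (Matrix.SpecialLinearGroup.toGL (σ i) : GL (Fin 2) ℝ)⁻¹ • Γ).strictPeriods =
    AddSubgroup.zmultiples 1)
  (hineq : ∀ i j, ∀ γ ∈ Γ, γ • 𝔞 i = 𝔞 j → i = j)
  (hcomplete : ∀ c : OnePoint ℝ, IsCusp c Γ → ∃ i, ∃ γ ∈ Γ, γ • 𝔞 i = c)
  (hY : 1 ≤ Y)

include hvol hinfty hper hineq hcomplete hY in
/-- **The continuation is that of every strip**: `φᵢⱼ = φ^κᵢⱼ` on the strip of any resolvent kernel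
`κ`. [folklore] -/
theorem contScat_eq_phiN (κ : RKernel) (i j : Fin h) {s : ℂ} (hs : s ∈ κ.strip) :
    contScat hΓ hneg hd hF σ Y i j s = phiN hΓ hneg hd hF σ κ Y i j s :=
  phiN_eqOn_inter hΓ hneg hd hF (stripKernel s) hvol hinfty hper hineq hcomplete hY κ i j ⟨mem_strip_stripKernel s, hs⟩

include hvol hinfty hper hineq hcomplete hY in
/-- The same for `[E^Y]`. [folklore] -/
theorem contEisH_eq_vN (κ : RKernel) (i : Fin h) {s : ℂ} (hs : s ∈ κ.strip) :
    contEisH hΓ hneg hd hF σ Y i s = vN hΓ hneg hd hF σ κ Y i s :=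
  vN_eqOn_inter hΓ hneg hd hF (stripKernel s) hvol hinfty hper hineq hcomplete hY κ i ⟨mem_strip_stripKernel s, hs⟩

include hvol hinfty hper hineq hcomplete hY in
/-- Near a point of a strip, `φᵢⱼ` is the strip's `φ^κᵢⱼ`. [folklore] -/
theorem contScat_eventuallyEq_phiN (κ : RKernel) (i j : Fin h) {s : ℂ} (hs : s ∈ κ.strip) :
    contScat hΓ hneg hd hF σ Y i j =ᶠ[𝓝 s] phiN hΓ hneg hd hF σ κ Y i j :=
  Filter.mem_of_superset (κ.isOpen_strip.mem_nhds hs) fun _ hw =>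
    contScat_eq_phiN hΓ hneg hd hF hvol hinfty hper hineq hcomplete hY κ i j hw

include hvol hinfty hper hineq hcomplete hY in
/-- Near a point of a strip, `[E^Y]` is the strip's `v^κ`. [folklore] -/
theorem contEisH_eventuallyEq_vN (κ : RKernel) (i : Fin h) {s : ℂ} (hs : s ∈ κ.strip) :
    contEisH hΓ hneg hd hF σ Y i =ᶠ[𝓝 s] vN hΓ hneg hd hF σ κ Y i :=
  Filter.mem_of_superset (κ.isOpen_strip.mem_nhds hs) fun _ hw =>
    contEisH_eq_vN hΓ hneg hd hF hvol hinfty hper hineq hcomplete hY κ i hw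

include hvol hinfty hper hineq hcomplete hY in
/-- **`φᵢⱼ` is meromorphic in normal form on `ℂ`.** [cite: Iwaniec2002, §6.2–6.3, PDF pp. 85–86] -/
theorem meromorphicNFOn_contScat (i j : Fin h) : MeromorphicNFOn (contScat hΓ hneg hd hF σ Y i j) univ := fun s _ =>
  (meromorphicNFAt_congr (contScat_eventuallyEq_phiN hΓ hneg hd hF hvol hinfty hper hineq hcomplete hY
    (stripKernel s) i j (mem_strip_stripKernel s))).mpr
    (meromorphicNFOn_phiN hΓ hneg hd hF σ (stripKernel s) Y i j (mem_strip_stripKernel s))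

include hvol hinfty hper hineq hcomplete hY in
/-- **`s ↦ [E^Y_𝔞ᵢ(·, s)]` is meromorphic in normal form on `ℂ`.** [cite: Iwaniec2002, Prop. 6.8 context, PDF p. 88] -/
theorem meromorphicNFOn_contEisH (i : Fin h) : MeromorphicNFOn (contEisH hΓ hneg hd hF σ Y i) univ := fun s _ =>
  (meromorphicNFAt_congr (contEisH_eventuallyEq_vN hΓ hneg hd hF hvol hinfty hper hineq hcomplete hY
    (stripKernel s) i (mem_strip_stripKernel s))).mpr
    (meromorphicNFOn_vN hΓ hneg hd hF σ (stripKernel s) Y i (mem_strip_stripKernel s))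

include hvol hinfty hper hineq hcomplete hY in
/-- `φᵢⱼ` is meromorphic on `ℂ`. [folklore] -/
theorem meromorphicOn_contScat (i j : Fin h) : MeromorphicOn (contScat hΓ hneg hd hF σ Y i j) univ :=
  (meromorphicNFOn_contScat hΓ hneg hd hF hvol hinfty hper hineq hcomplete hY i j).meromorphicOn

include hvol hinfty hper hineq hcomplete hY in
/-- `[E^Y]` is meromorphic on `ℂ`. [folklore] -/
theorem meromorphicOn_contEisH (i : Fin h) : MeromorphicOn (contEisH hΓ hneg hd hF σ Y i) univ :=
  (meromorphicNFOn_contEisH hΓ hneg hd hF hvol hinfty hper hineq hcomplete hY i).meromorphicOn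

include hvol hinfty hper hineq hcomplete hY in
/-- **For `Re s > 1`, `φᵢⱼ(s)` is the scattering coefficient of the series.** [cite: Iwaniec2002, (3.21)–(3.22) & §6.2, PDF pp. 46, 85] -/
theorem contScat_eq_eisScattering (i j : Fin h) {s : ℂ} (hs : 1 < s.re) :
    contScat hΓ hneg hd hF σ Y i j s = eisScattering Γ σ i j s :=
  phiN_eq_eisScattering hΓ hneg hd hF (stripKernel s) hvol hinfty hper hineq hcomplete hY i j (mem_strip_stripKernel s) hs

include hvol hinfty hper hineq hcomplete hY in
/-- **For `Re s > 1`, `[E^Y_𝔞ᵢ(·, s)]` is the class of the truncated series.** [cite: Iwaniec2002, (6.29), PDF p. 88] -/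
theorem coe_contEisH_eq_eisTruncLp (i : Fin h) {s : ℂ} (hs : 1 < s.re) :
    ((contEisH hΓ hneg hd hF σ Y i s : pseudoCuspSubmodule hΓ hneg hd hF σ Y) : Lp ℂ 2 (volume.restrict F)) =
      eisTruncLp Γ F σ i s Y :=
  coe_vN_eq_eisTruncLp hΓ hneg hd hF (stripKernel s) hvol hinfty hper hineq hcomplete hY i (mem_strip_stripKernel s) hs

include hvol hinfty hper hineq hcomplete hY in
/-- `φᵢⱼ` is analytic on `Re s > 1`. [folklore] -/
theorem analyticAt_contScat_of_one_lt_re (i j : Fin h) {s : ℂ} (hs : 1 < s.re) :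
    AnalyticAt ℂ (contScat hΓ hneg hd hF σ Y i j) s :=
  (analyticAt_congr (contScat_eventuallyEq_phiN hΓ hneg hd hF hvol hinfty hper hineq hcomplete hY (stripKernel s) i j
    (mem_strip_stripKernel s))).mpr
    ((phiN_eqOn_and_analyticOnNhd hΓ hneg hd hF (stripKernel s) hvol hinfty hper hineq hcomplete hY i j).2 s
      ⟨mem_strip_stripKernel s, hs⟩)

include hvol hinfty hper hineq hcomplete hY in
/-- `[E^Y]` is analytic on `Re s > 1`. [folklore] -/
theorem analyticAt_contEisH_of_one_lt_re (i : Fin h) {s : ℂ} (hs : 1 < s.re) :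
    AnalyticAt ℂ (contEisH hΓ hneg hd hF σ Y i) s :=
  (analyticAt_congr (contEisH_eventuallyEq_vN hΓ hneg hd hF hvol hinfty hper hineq hcomplete hY (stripKernel s) i
    (mem_strip_stripKernel s))).mpr
    ((vN_eqOn_and_analyticOnNhd hΓ hneg hd hF (stripKernel s) hvol hinfty hper hineq hcomplete hY i).2 s
      ⟨mem_strip_stripKernel s, hs⟩)

include hvol hinfty hper hineq hcomplete hY in
/-- **Every `s` with `Re s > 1` is regular.** [cite: Iwaniec2002, §6.3, PDF p. 86] -/
theorem isEisRegular_of_one_lt_re (i : Fin h) {s : ℂ} (hs : 1 < s.re) : IsEisRegular hΓ hneg hd hF σ Y i s :=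
  ⟨analyticAt_contEisH_of_one_lt_re hΓ hneg hd hF hvol hinfty hper hineq hcomplete hY i hs,
    fun j => analyticAt_contScat_of_one_lt_re hΓ hneg hd hF hvol hinfty hper hineq hcomplete hY i j hs⟩

/-- The set of regular points is open. [folklore] -/
theorem isOpen_setOf_isEisRegular (i : Fin h) : IsOpen {s : ℂ | IsEisRegular hΓ hneg hd hF σ Y i s} := by
  have e : {s : ℂ | IsEisRegular hΓ hneg hd hF σ Y i s} =
      {s | AnalyticAt ℂ (contEisH hΓ hneg hd hF σ Y i) s} ∩ ⋂ j, {s | AnalyticAt ℂ (contScat hΓ hneg hd hF σ Y i j) s} := by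
    ext s; simp [IsEisRegular]
  rw [e]
  exact (isOpen_analyticAt ℂ _).inter (isOpen_iInter_of_finite fun j => isOpen_analyticAt ℂ _)

include hvol hinfty hper hineq hcomplete hY in
/-- **At a non-regular point (a pole) the continued objects take the value `0`** — they are in
normal form: `[E^Y]` is analytic at `s` or has a pole there with value `0`. [folklore] -/
theorem analyticAt_contEisH_or (i : Fin h) (s : ℂ) :
    AnalyticAt ℂ (contEisH hΓ hneg hd hF σ Y i) s ∨
      (meromorphicOrderAt (contEisH hΓ hneg hd hF σ Y i) s < 0 ∧ contEisH hΓ hneg hd hF σ Y i s = 0) := by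
  rcases meromorphicNFAt_iff_analyticAt_or.mp
    (meromorphicNFOn_contEisH hΓ hneg hd hF hvol hinfty hper hineq hcomplete hY i (mem_univ s)) with h1 | h1
  · exact Or.inl h1
  · exact Or.inr ⟨h1.2.1, h1.2.2⟩

include hvol hinfty hper hineq hcomplete hY in
/-- The same for `φᵢⱼ`. [folklore] -/
theorem analyticAt_contScat_or (i j : Fin h) (s : ℂ) :
    AnalyticAt ℂ (contScat hΓ hneg hd hF σ Y i j) s ∨
      (meromorphicOrderAt (contScat hΓ hneg hd hF σ Y i j) s < 0 ∧ contScat hΓ hneg hd hF σ Y i j s = 0) := by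
  rcases meromorphicNFAt_iff_analyticAt_or.mp
    (meromorphicNFOn_contScat hΓ hneg hd hF hvol hinfty hper hineq hcomplete hY i j (mem_univ s)) with h1 | h1
  · exact Or.inl h1
  · exact Or.inr ⟨h1.2.1, h1.2.2⟩

include hvol hinfty hper hineq hcomplete hY in
/-- **The resolvent identity at every regular point, for every Lipschitz test kernel `k`**:
`(T_k - ĥ_k(s)) [E^Y_𝔞ᵢ(·, s)] + [a_{k,i}^s] + Σⱼ φᵢⱼ(s) [a_{k,j}^{1-s}] = 0` in `L²(F)`.
[cite: Iwaniec2002, §6.3 "(6.20)–(6.21) … remain valid for all regular `s`", PDF p. 86] -/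
theorem resolventIdentity_cont {k : ℝ → ℝ} {L : ℝ≥0} {Bk M : ℝ} (hk : IsTestKernel k) (hL : LipschitzWith L k)
    (hBk : ∀ u, |k u| ≤ Bk) (hM : ∀ u, M ≤ u → k u = 0) (i : Fin h) {s : ℂ} (hreg : IsEisRegular hΓ hneg hd hF σ Y i s) :
    kernelCLM hΓ hneg hd hF hk hL.continuous
        ((contEisH hΓ hneg hd hF σ Y i s : pseudoCuspSubmodule hΓ hneg hd hF σ Y) : Lp ℂ 2 (volume.restrict F))
      - eigenvalueFn k s • ((contEisH hΓ hneg hd hF σ Y i s : pseudoCuspSubmodule hΓ hneg hd hF σ Y) : Lp ℂ 2 (volume.restrict F))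
      + tailDefectLp Γ F σ k i s Y + ∑ j, contScat hΓ hneg hd hF σ Y i j s • tailDefectLp Γ F σ k j (1 - s) Y = 0 := by
  set κ := stripKernel s with hκ
  have hs := mem_strip_stripKernel s
  have hv : AnalyticAt ℂ (vN hΓ hneg hd hF σ κ Y i) s :=
    (analyticAt_congr (contEisH_eventuallyEq_vN hΓ hneg hd hF hvol hinfty hper hineq hcomplete hY κ i hs)).mp hreg.1
  have hφ : ∀ j, AnalyticAt ℂ (phiN hΓ hneg hd hF σ κ Y i j) s := fun j =>
    (analyticAt_congr (contScat_eventuallyEq_phiN hΓ hneg hd hF hvol hinfty hper hineq hcomplete hY κ i j hs)).mp (hreg.2 j)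
  have h0 := residK_eq_zero hΓ hneg hd hF κ hvol hinfty hper hineq hcomplete hY hk hL hBk hM i hs hv hφ
  unfold residK at h0
  exact h0

end Patching

/-! ## 2. The Laplacian kernel of the bump kernels (for Theorem 1.9) -/

section BumpLap

variable {M : ℝ} (hM : 0 < M)

/-- The bump kernel has compact support. [folklore] -/
theorem hasCompactSupport_bumpKernel : HasCompactSupport (bumpKernel M hM) := ContDiffBump.hasCompactSupport _

/-- Its derivatives are genuine derivatives. [folklore] -/
theorem hasDerivAt_bumpKernel (u : ℝ) : HasDerivAt (bumpKernel M hM) (deriv (bumpKernel M hM) u) u :=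
  (((contDiff_bumpKernel hM 1).differentiable (by norm_num)) u).hasDerivAt

/-- The derivative is `C^∞`. [folklore] -/
theorem contDiff_deriv_bumpKernel (n : ℕ∞) : ContDiff ℝ n (deriv (bumpKernel M hM)) :=
  (contDiff_bumpKernel hM (n + 1)).deriv'

/-- Second derivatives. [folklore] -/
theorem hasDerivAt_deriv_bumpKernel (u : ℝ) :
    HasDerivAt (deriv (bumpKernel M hM)) (deriv (deriv (bumpKernel M hM)) u) u :=
  (((contDiff_deriv_bumpKernel hM 1).differentiable (by norm_num)) u).hasDerivAt

/-- **The Laplacian kernel `k_Δ = u(u+1)k'' + (2u+1)k'`** of the bump kernel (Lemma 1.8). [cite: Iwaniec2002, Lemma 1.8, PDF p. 21] -/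
def bumpLap (M : ℝ) (hM : 0 < M) : ℝ → ℝ :=
  kernelLaplacian (deriv (bumpKernel M hM)) (deriv (deriv (bumpKernel M hM)))

/-- `k_Δ` is smooth. [folklore] -/
theorem contDiff_bumpLap (n : ℕ∞) : ContDiff ℝ n (bumpLap M hM) := by
  unfold bumpLap kernelLaplacian
  have h1 := contDiff_deriv_bumpKernel hM n
  have h2 : ContDiff ℝ n (deriv (deriv (bumpKernel M hM))) := (contDiff_deriv_bumpKernel hM (n + 1)).deriv'
  exact ((contDiff_id.mul (contDiff_id.add contDiff_const)).mul h2).add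
    (((contDiff_const.mul contDiff_id).add contDiff_const).mul h1)

/-- `k_Δ = 0` on `(M, ∞)`. [folklore] -/
theorem bumpLap_eq_zero {u : ℝ} (hu : M < u) : bumpLap M hM u = 0 :=
  kernelLaplacian_eq_zero (hasDerivAt_bumpKernel hM) (hasDerivAt_deriv_bumpKernel hM)
    (fun _ hv => bumpKernel_eq_zero hM hv) hu

/-- `k_Δ` has compact support. [folklore] -/
theorem hasCompactSupport_bumpLap : HasCompactSupport (bumpLap M hM) := by
  have h1 : HasCompactSupport (deriv (bumpKernel M hM)) := (hasCompactSupport_bumpKernel hM).deriv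
  have h2 : HasCompactSupport (deriv (deriv (bumpKernel M hM))) := h1.deriv
  have e : bumpLap M hM = (fun u : ℝ => u * (u + 1)) * deriv (deriv (bumpKernel M hM)) +
      (fun u : ℝ => 2 * u + 1) * deriv (bumpKernel M hM) := by
    funext u; simp [bumpLap, kernelLaplacian]
  rw [e]
  exact (h2.mul_left).add h1.mul_left

/-- `k_Δ` is bounded. [folklore] -/
theorem exists_bound_bumpLap : ∃ B, ∀ u, |bumpLap M hM u| ≤ B := by
  obtain ⟨C, hC⟩ := (hasCompactSupport_bumpLap hM).exists_bound_of_continuous (contDiff_bumpLap hM 0).continuous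
  exact ⟨C, fun u => by rw [← Real.norm_eq_abs]; exact hC u⟩

/-- **`k_Δ` is a test kernel.** [folklore] -/
theorem isTestKernel_bumpLap : IsTestKernel (bumpLap M hM) where
  measurable := (contDiff_bumpLap hM 0).continuous.measurable
  bounded := exists_bound_bumpLap hM
  eventually_zero := ⟨M + 1, by linarith, fun u hu => bumpLap_eq_zero hM (by linarith)⟩

/-- `k_Δ` is Lipschitz. [folklore] -/
theorem exists_lipschitzWith_bumpLap : ∃ L : ℝ≥0, LipschitzWith L (bumpLap M hM) :=
  lipschitzWith_of_hasCompactSupport_deriv (contDiff_bumpLap hM 1) (hasCompactSupport_bumpLap hM).deriv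

/-- **`ĥ_{k_Δ}(s) = -s(1-s) ĥ_k(s)`** (Theorem 1.9 with Theorem 1.16). [cite: Iwaniec2002, Thms 1.9 & 1.16, PDF pp. 21, 24] -/
theorem eigenvalueFn_bumpLap (s : ℂ) :
    eigenvalueFn (bumpLap M hM) s = -(s * (1 - s)) * eigenvalueFn (bumpKernel M hM) s := by
  unfold eigenvalueFn bumpLap
  rw [selbergTransform_kernelLaplacian (isTestKernel_bumpKernel hM) (hasDerivAt_bumpKernel hM)
    (hasDerivAt_deriv_bumpKernel hM) (contDiff_bumpKernel hM 2)]
  congr 1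
  have : (1 / 4 + (-Complex.I * (s - 1 / 2)) ^ 2 : ℂ) = s * (1 - s) := by
    ring_nf; rw [Complex.I_sq]; ring
  rw [this]

end BumpLap

/-! ## 3. The continued Eisenstein series as functions on `ℍ` -/

section Functions

variable (hΓ : Γ ≤ (Matrix.SpecialLinearGroup.toGL : SL(2, ℝ) →* GL (Fin 2) ℝ).range)
  (hneg : (-1 : GL (Fin 2) ℝ) ∈ Γ) (hd : IsDiscreteSubgroup Γ) (hF : IsHypFundamentalDomain Γ F)
  (σ : Fin h → SL(2, ℝ)) (Y : ℝ)

/-- **The locally integrable representative** `Ẽᵢ(·, s) = ([E^Y(s)])^Γ + θᵢ^s + Σⱼ φᵢⱼ(s) θⱼ^{1-s}`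
(automorphic extension of the `L²_Y`-part plus the tails). [cite: Iwaniec2002, §6.2 (6.10), PDF p. 84] -/
def contEisRep (i : Fin h) (s : ℂ) : ℍ → ℂ := fun z =>
  autExt Γ F (⇑(((contEisH hΓ hneg hd hF σ Y i s : pseudoCuspSubmodule hΓ hneg hd hF σ Y) :
      Lp ℂ 2 (volume.restrict F)))) z +
    tailEis Γ σ i s Y z + ∑ j, contScat hΓ hneg hd hF σ Y i j s * tailEis Γ σ j (1 - s) Y z

/-- **The continued Eisenstein series** `E_𝔞ᵢ(z, s) := ĥ_k(s)⁻¹ (L_k Ẽᵢ(·, s))(z)`, `k` the resolvent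
kernel of the strip of `s` — the continuous (indeed `C²`) representative of `Ẽᵢ(·, s)` at the regular
points (Theorem 1.16: `E = ĥ⁻¹ L_k E`). [cite: Iwaniec2002, Thm 6.5 context & Thm 1.16, PDF pp. 24, 86] -/
def contEis (i : Fin h) (s : ℂ) (z : ℍ) : ℂ :=
  (eigenvalueFn (stripKernel s).k s)⁻¹ * invariantOperator (stripKernel s).k (contEisRep hΓ hneg hd hF σ Y i s) z

variable {σ Y}
variable (hvol : volume F < ⊤)
  (hinfty : ∀ i, (Matrix.SpecialLinearGroup.toGL (σ i) : GL (Fin 2) ℝ) • (OnePoint.infty : OnePoint ℝ) = 𝔞 i)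
  (hper : ∀ i, (ConjAct.toConjAct (Matrix.SpecialLinearGroup.toGL (σ i) : GL (Fin 2) ℝ)⁻¹ • Γ).strictPeriods =
    AddSubgroup.zmultiples 1)
  (hineq : ∀ i j, ∀ γ ∈ Γ, γ • 𝔞 i = 𝔞 j → i = j)
  (hcomplete : ∀ c : OnePoint ℝ, IsCusp c Γ → ∃ i, ∃ γ ∈ Γ, γ • 𝔞 i = c)
  (hY : 1 ≤ Y)

include hΓ in
/-- `Ẽᵢ(·, s)` is automorphic. [folklore] -/
theorem isAutomorphic_contEisRep (i : Fin h) (s : ℂ) : IsAutomorphic Γ (contEisRep hΓ hneg hd hF σ Y i s) := by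
  intro γ hγ z
  unfold contEisRep
  rw [(isAutomorphic_autExt (Γ := Γ) (F := F) _) γ hγ z, isAutomorphic_tailEis hΓ i s Y γ hγ z]
  congr 1
  exact Finset.sum_congr rfl fun j _ => by rw [isAutomorphic_tailEis hΓ j (1 - s) Y γ hγ z]

include hinfty hper hineq hY in
/-- `Ẽᵢ(·, s)` is locally integrable. [folklore] -/
theorem locallyIntegrable_contEisRep (i : Fin h) (s : ℂ) : LocallyIntegrable (contEisRep hΓ hneg hd hF σ Y i s) := by
  unfold contEisRep
  refine ((locallyIntegrable_autExt hΓ hneg hd hF (Lp.memLp _)).add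
    (locallyIntegrable_tailEis hΓ hneg hd hinfty hper hineq i s hY)).add ?_
  exact locallyIntegrable_finsetSum Finset.univ fun j _ =>
    (locallyIntegrable_tailEis hΓ hneg hd hinfty hper hineq j (1 - s) hY).smul (contScat hΓ hneg hd hF σ Y i j s)

include hvol hinfty hper hineq hcomplete hY in
/-- **`(L_k - ĥ_k(s)) Ẽᵢ(·, s) = 0` a.e. on `ℍ`** at a regular `s`, for every Lipschitz test kernel `k`
(the resolvent identity read on `ℍ` through the automorphic extension). [cite: Iwaniec2002, §6.3 (6.20)–(6.21) "remain valid for all regular `s`", PDF p. 86] -/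
theorem invariantOperator_contEisRep_ae_eq {k : ℝ → ℝ} {L : ℝ≥0} {Bk M : ℝ} (hk : IsTestKernel k)
    (hL : LipschitzWith L k) (hBk : ∀ u, |k u| ≤ Bk) (hM : ∀ u, M ≤ u → k u = 0) (i : Fin h) {s : ℂ}
    (hreg : IsEisRegular hΓ hneg hd hF σ Y i s) :
    invariantOperator k (contEisRep hΓ hneg hd hF σ Y i s) =ᵐ[volume]
      fun z => eigenvalueFn k s * contEisRep hΓ hneg hd hF σ Y i s z := by
  -- notation
  set v : Lp ℂ 2 (volume.restrict F) :=
    ((contEisH hΓ hneg hd hF σ Y i s : pseudoCuspSubmodule hΓ hneg hd hF σ Y) : Lp ℂ 2 (volume.restrict F)) with hv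
  set V : ℍ → ℂ := autExt Γ F (⇑v) with hV
  set c : ℂ := eigenvalueFn k s with hc
  set φ : Fin h → ℂ := fun j => contScat hΓ hneg hd hF σ Y i j s with hφ
  set θ₀ : ℍ → ℂ := tailEis Γ σ i s Y with hθ₀
  set θ : Fin h → ℍ → ℂ := fun j => tailEis Γ σ j (1 - s) Y with hθ
  set a₀ : ℍ → ℂ := tailDefect Γ σ k i s Y with ha₀
  set a : Fin h → ℍ → ℂ := fun j => tailDefect Γ σ k j (1 - s) Y with ha
  have hVl : LocallyIntegrable V := locallyIntegrable_autExt hΓ hneg hd hF (Lp.memLp v)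
  have hVa : IsAutomorphic Γ V := isAutomorphic_autExt _
  have hθ₀l : LocallyIntegrable θ₀ := locallyIntegrable_tailEis hΓ hneg hd hinfty hper hineq i s hY
  have hθl : ∀ j, LocallyIntegrable (θ j) := fun j => locallyIntegrable_tailEis hΓ hneg hd hinfty hper hineq j (1 - s) hY
  have hmemD : ∀ (j : Fin h) (w : ℂ), MemLp (tailDefect Γ σ k j w Y) 2 (volume.restrict F) := fun j w =>
    memLp_tailDefect (F := F) hΓ hneg hd hvol hinfty hper hineq hk hL hBk hM j w hY
  -- Step 1: the identity in `L²(F)` read a.e. on `F`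
  have hE := resolventIdentity_cont hΓ hneg hd hF hvol hinfty hper hineq hcomplete hY hk hL hBk hM i hreg
  rw [← hv] at hE
  have hsm : ∀ j, (⇑(φ j • tailDefectLp Γ F σ k j (1 - s) Y) : ℍ → ℂ) =ᵐ[volume.restrict F] fun z => φ j * a j z := by
    intro j
    filter_upwards [Lp.coeFn_smul (φ j) (tailDefectLp Γ F σ k j (1 - s) Y), tailDefectLp_coeFn (hmemD j (1 - s))]
      with z hz1 hz2
    rw [hz1, Pi.smul_apply, hz2, smul_eq_mul]
  have hF1 : (fun z => invariantOperator k V z + a₀ z + ∑ j, φ j * a j z) =ᵐ[volume.restrict F] fun z => c * v z := by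
    have h0 := (Lp.ext_iff.mp hE)
    filter_upwards [h0, Lp.coeFn_add (kernelCLM hΓ hneg hd hF hk hL.continuous v - c • v + tailDefectLp Γ F σ k i s Y)
        (∑ j, φ j • tailDefectLp Γ F σ k j (1 - s) Y),
      Lp.coeFn_add (kernelCLM hΓ hneg hd hF hk hL.continuous v - c • v) (tailDefectLp Γ F σ k i s Y),
      Lp.coeFn_sub (kernelCLM hΓ hneg hd hF hk hL.continuous v) (c • v), Lp.coeFn_smul c v,
      kernelCLM_coeFn hΓ hneg hd hF hk hL.continuous v,
      Lp.coeFn_fun_finsetSum Finset.univ (fun j => φ j • tailDefectLp Γ F σ k j (1 - s) Y),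
      ae_all_iff.mpr hsm, tailDefectLp_coeFn (hmemD i s), Lp.coeFn_zero ℂ 2 (volume.restrict F)]
      with z h0 h1 h2 h3 h4 h5 h6 h7 h8 h9
    rw [h1, Pi.add_apply, h2, Pi.add_apply, h3, Pi.sub_apply, h4, Pi.smul_apply, h5, h6, h8, h9, Pi.zero_apply,
      smul_eq_mul, Finset.sum_congr rfl fun j _ => h7 j, kernelOp_eq_invariantOperator hΓ hneg hd hF hk (Lp.memLp v) z] at h0
    linear_combination h0
  -- Step 2: transport to `ℍ` through the automorphic extension
  have hG₁a : IsAutomorphic Γ (fun z => invariantOperator k V z + a₀ z + ∑ j, φ j * a j z) := by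
    intro γ hγ z
    simp only
    rw [← invariantOperator_comp_smul_of_mem_range k V (hΓ hγ) z]
    have e1 : (fun w => V (γ • w)) = V := funext fun w => hVa γ hγ w
    have ha₀γ : a₀ (γ • z) = a₀ z := isAutomorphic_tailDefect hΓ k i s Y γ hγ z
    have haγ : ∀ j, a j (γ • z) = a j z := fun j => isAutomorphic_tailDefect hΓ k j (1 - s) Y γ hγ z
    rw [e1, ha₀γ]
    simp_rw [haγ]
  have hH : (fun z => invariantOperator k V z + a₀ z + ∑ j, φ j * a j z) =ᵐ[volume] fun z => c * V z := by
    have h1 := autExt_congr_ae hΓ hneg hd hF hF1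
    have h2 := autExt_ae_eq_of_isAutomorphic hΓ hneg hd hF hG₁a
    filter_upwards [h1, h2] with z hz1 hz2
    rw [← hz2, hz1, autExt_const_mul]
  -- Step 3: expand `L_k Ẽ`
  have hLsum : ∀ z, invariantOperator k (contEisRep hΓ hneg hd hF σ Y i s) z =
      invariantOperator k V z + invariantOperator k θ₀ z + ∑ j, φ j * invariantOperator k (θ j) z := by
    intro z
    have e : contEisRep hΓ hneg hd hF σ Y i s = fun w => V w + θ₀ w + ∑ j, φ j * θ j w := rfl
    have hl1 : LocallyIntegrable (fun w => V w + θ₀ w) := hVl.add hθ₀l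
    have hl3 : ∀ j ∈ Finset.univ, LocallyIntegrable (fun w => φ j * θ j w) := fun j _ => (hθl j).smul (φ j)
    have hl2 : LocallyIntegrable (fun w => ∑ j, φ j * θ j w) := locallyIntegrable_finsetSum Finset.univ hl3
    have h1 : invariantOperator k (fun w => V w + θ₀ w + ∑ j, φ j * θ j w) z =
        invariantOperator k (fun w => V w + θ₀ w) z + invariantOperator k (fun w => ∑ j, φ j * θ j w) z :=
      invariantOperator_add hk hl1 hl2 z
    have h2 : invariantOperator k (fun w => V w + θ₀ w) z = invariantOperator k V z + invariantOperator k θ₀ z :=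
      invariantOperator_add hk hVl hθ₀l z
    have h3 : invariantOperator k (fun w => ∑ j, φ j * θ j w) z = ∑ j, invariantOperator k (fun w => φ j * θ j w) z :=
      invariantOperator_finset_sum hk Finset.univ (f := fun j w => φ j * θ j w) hl3 z
    have h4 : ∀ j, invariantOperator k (fun w => φ j * θ j w) z = φ j * invariantOperator k (θ j) z := fun j =>
      invariantOperator_const_mul k (φ j) (θ j) z
    rw [e, h1, h2, h3]
    congr 1
    exact Finset.sum_congr rfl fun j _ => h4 j
  have ha₀' : ∀ z, a₀ z = invariantOperator k θ₀ z - c * θ₀ z := fun z => rfl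
  have ha' : ∀ j z, a j z = invariantOperator k (θ j) z - c * θ j z := by
    intro j z
    show tailDefect Γ σ k j (1 - s) Y z = _
    unfold tailDefect
    rw [eigenvalueFn_one_sub]
  filter_upwards [hH] with z hz
  rw [hLsum z]
  have e : contEisRep hΓ hneg hd hF σ Y i s z = V z + θ₀ z + ∑ j, φ j * θ j z := rfl
  rw [e]
  have hz' := hz
  simp only [ha₀', ha', mul_sub, Finset.sum_sub_distrib] at hz'
  have e2 : ∑ x, φ x * (c * θ x z) = c * ∑ x, φ x * θ x z := by
    rw [Finset.mul_sum]
    exact Finset.sum_congr rfl fun x _ => by ring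
  rw [e2] at hz'
  rw [mul_add, mul_add]
  linear_combination hz'

end Functions

/-! ## 4. The continued Eisenstein series at a regular point: automorphic `C²` eigenfunctions -/

section Regular

variable (hΓ : Γ ≤ (Matrix.SpecialLinearGroup.toGL : SL(2, ℝ) →* GL (Fin 2) ℝ).range)
  (hneg : (-1 : GL (Fin 2) ℝ) ∈ Γ) (hd : IsDiscreteSubgroup Γ) (hF : IsHypFundamentalDomain Γ F)
  (hvol : volume F < ⊤)
  (hinfty : ∀ i, (Matrix.SpecialLinearGroup.toGL (σ i) : GL (Fin 2) ℝ) • (OnePoint.infty : OnePoint ℝ) = 𝔞 i)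
  (hper : ∀ i, (ConjAct.toConjAct (Matrix.SpecialLinearGroup.toGL (σ i) : GL (Fin 2) ℝ)⁻¹ • Γ).strictPeriods =
    AddSubgroup.zmultiples 1)
  (hineq : ∀ i j, ∀ γ ∈ Γ, γ • 𝔞 i = 𝔞 j → i = j)
  (hcomplete : ∀ c : OnePoint ℝ, IsCusp c Γ → ∃ i, ∃ γ ∈ Γ, γ • 𝔞 i = c)
  {Y : ℝ} (hY : 1 ≤ Y)

/-- `ĥ_k(s) ≠ 0` for the kernel of the strip of `s`. [folklore] -/
theorem eigenvalueFn_stripKernel_ne_zero (s : ℂ) : eigenvalueFn (stripKernel s).k s ≠ 0 :=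
  (stripKernel s).eigenvalueFn_ne_zero (mem_strip_stripKernel s)

include hvol hinfty hper hineq hcomplete hY in
/-- **`E_𝔞ᵢ(·, s) = Ẽᵢ(·, s)` a.e.** at a regular point. [folklore] -/
theorem contEis_ae_eq_contEisRep (i : Fin h) {s : ℂ} (hreg : IsEisRegular hΓ hneg hd hF σ Y i s) :
    contEis hΓ hneg hd hF σ Y i s =ᵐ[volume] contEisRep hΓ hneg hd hF σ Y i s := by
  have h1 := invariantOperator_contEisRep_ae_eq hΓ hneg hd hF hvol hinfty hper hineq hcomplete hY (stripKernel s).test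
    (stripKernel s).lip (stripKernel s).bound (stripKernel s).supp i hreg
  filter_upwards [h1] with z hz
  unfold contEis
  rw [hz, ← mul_assoc, inv_mul_cancel₀ (eigenvalueFn_stripKernel_ne_zero s), one_mul]

include hinfty hper hineq hY in
/-- **`E_𝔞ᵢ(·, s)` is continuous** (for every `s`). [folklore] -/
theorem continuous_contEis (i : Fin h) (s : ℂ) : Continuous (contEis hΓ hneg hd hF σ Y i s) :=
  continuous_const.mul (continuous_invariantOperator (stripKernel s).test (stripKernel s).lip (stripKernel s).supp
    (locallyIntegrable_contEisRep hΓ hneg hd hF hinfty hper hineq hY i s))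

include hΓ in
/-- **`E_𝔞ᵢ(·, s)` is automorphic** (for every `s`). [cite: Iwaniec2002, Thm 6.5 context, PDF p. 86] -/
theorem isAutomorphic_contEis (i : Fin h) (s : ℂ) : IsAutomorphic Γ (contEis hΓ hneg hd hF σ Y i s) := by
  intro γ hγ z
  unfold contEis
  congr 1
  rw [← invariantOperator_comp_smul_of_mem_range _ _ (hΓ hγ) z]
  congr 1
  funext w
  exact isAutomorphic_contEisRep hΓ hneg hd hF i s γ hγ w

include hvol hinfty hper hineq hcomplete hY in
/-- **`L_k E_𝔞ᵢ(·, s) = ĥ_k(s) E_𝔞ᵢ(·, s)` pointwise**, at a regular `s`, for every Lipschitz test kernel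
`k` (both sides are continuous and agree a.e.). [cite: Iwaniec2002, Thm 1.16 & §6.3, PDF pp. 24, 86] -/
theorem invariantOperator_contEis {k : ℝ → ℝ} {L : ℝ≥0} {Bk M : ℝ} (hk : IsTestKernel k)
    (hL : LipschitzWith L k) (hBk : ∀ u, |k u| ≤ Bk) (hM : ∀ u, M ≤ u → k u = 0) (i : Fin h) {s : ℂ}
    (hreg : IsEisRegular hΓ hneg hd hF σ Y i s) (z : ℍ) :
    invariantOperator k (contEis hΓ hneg hd hF σ Y i s) z = eigenvalueFn k s * contEis hΓ hneg hd hF σ Y i s z := by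
  have hcE := continuous_contEis hΓ hneg hd hF hinfty hper hineq hY i s
  have hcont1 : Continuous (invariantOperator k (contEis hΓ hneg hd hF σ Y i s)) :=
    continuous_invariantOperator hk hL hM hcE.locallyIntegrable
  have hae := contEis_ae_eq_contEisRep hΓ hneg hd hF hvol hinfty hper hineq hcomplete hY i hreg
  have e1 : invariantOperator k (contEis hΓ hneg hd hF σ Y i s) = invariantOperator k (contEisRep hΓ hneg hd hF σ Y i s) :=
    funext fun z => invariantOperator_congr_ae hae z
  have e2 : invariantOperator k (contEis hΓ hneg hd hF σ Y i s) =ᵐ[volume]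
      fun z => eigenvalueFn k s * contEis hΓ hneg hd hF σ Y i s z := by
    rw [e1]
    filter_upwards [invariantOperator_contEisRep_ae_eq hΓ hneg hd hF hvol hinfty hper hineq hcomplete hY hk hL hBk hM i hreg,
      hae] with z hz hz'
    rw [hz, hz']
  have e3 : (fun z => invariantOperator k (contEis hΓ hneg hd hF σ Y i s) z -
      eigenvalueFn k s * contEis hΓ hneg hd hF σ Y i s z) = 0 := by
    refine eq_zero_of_continuous_of_ae_eq_zero (hcont1.sub (continuous_const.mul hcE)) ?_
    filter_upwards [e2] with z hz
    rw [Pi.zero_apply, hz, sub_self]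
  have := congrFun e3 z
  rwa [Pi.zero_apply, sub_eq_zero] at this

include hvol hinfty hper hineq hcomplete hY in
/-- **`E_𝔞ᵢ(·, s)` is `C²` and `(Δ + s(1-s)) E_𝔞ᵢ(·, s) = 0`** at a regular `s` (Theorem 1.9 for the
smooth resolvent kernel: `E = ĥ⁻¹ L_k Ẽ ∈ C²`, `Δ E = ĥ⁻¹ L_{k_Δ} Ẽ = ĥ⁻¹ ĥ_{k_Δ}(s) E = -s(1-s) E`).
[cite: Iwaniec2002, Thm 6.5 context ("`E_𝔞(z,s) ∈ 𝒜_s`") & Thms 1.9, 1.16, PDF pp. 21, 24, 86] -/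
theorem isC2_contEis_and_hypLaplacian (i : Fin h) {s : ℂ} (hreg : IsEisRegular hΓ hneg hd hF σ Y i s) :
    IsC2 (contEis hΓ hneg hd hF σ Y i s) ∧
      ∀ z, hypLaplacian (contEis hΓ hneg hd hF σ Y i s) z + s * (1 - s) * contEis hΓ hneg hd hF σ Y i s z = 0 := by
  have hM : 0 < stripSupport (stripIndex s) := stripSupport_pos _
  have hli := locallyIntegrable_contEisRep hΓ hneg hd hF hinfty hper hineq hY i s
  have h19 := isC2_invariantOperator_and_hypLaplacian (contDiff_bumpKernel hM 2) (isTestKernel_bumpKernel hM)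
    (hasDerivAt_bumpKernel hM) (hasDerivAt_deriv_bumpKernel hM) hli
  have e : contEis hΓ hneg hd hF σ Y i s = fun z => (eigenvalueFn (bumpKernel _ hM) s)⁻¹ *
      invariantOperator (bumpKernel _ hM) (contEisRep hΓ hneg hd hF σ Y i s) z := rfl
  have hC2 : IsC2 (contEis hΓ hneg hd hF σ Y i s) := by rw [e]; exact h19.1.const_mul _
  refine ⟨hC2, fun z => ?_⟩
  have hΔ : hypLaplacian (contEis hΓ hneg hd hF σ Y i s) z =
      (eigenvalueFn (bumpKernel _ hM) s)⁻¹ * invariantOperator (bumpLap _ hM) (contEisRep hΓ hneg hd hF σ Y i s) z := by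
    rw [e, hypLaplacian_const_mul' h19.1, h19.2 z]
    rfl
  obtain ⟨Lg, hLg⟩ := exists_lipschitzWith_bumpLap hM
  obtain ⟨Bg, hBg⟩ := exists_bound_bumpLap hM
  have hgM : ∀ u, stripSupport (stripIndex s) + 1 ≤ u → bumpLap _ hM u = 0 := fun u hu => bumpLap_eq_zero hM (by linarith)
  have e1 : invariantOperator (bumpLap _ hM) (contEisRep hΓ hneg hd hF σ Y i s) z =
      invariantOperator (bumpLap _ hM) (contEis hΓ hneg hd hF σ Y i s) z :=
    invariantOperator_congr_ae (contEis_ae_eq_contEisRep hΓ hneg hd hF hvol hinfty hper hineq hcomplete hY i hreg).symm z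
  rw [hΔ, e1, invariantOperator_contEis hΓ hneg hd hF hvol hinfty hper hineq hcomplete hY (isTestKernel_bumpLap hM) hLg hBg hgM
    i hreg z, eigenvalueFn_bumpLap]
  have hne : eigenvalueFn (bumpKernel _ hM) s ≠ 0 := eigenvalueFn_stripKernel_ne_zero s
  field_simp
  ring

include hvol hinfty hper hineq hcomplete hY in
/-- **For `Re s > 1` the continuation IS the Eisenstein series: `E_𝔞ᵢ(z, s) = Σ_{γ ∈ Γᵢ\Γ} (Im σᵢ⁻¹γz)^s`.**
[cite: Iwaniec2002, (3.11) & Thm 6.5, PDF pp. 43, 86] -/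
theorem contEis_eq_eisCusp (i : Fin h) {s : ℂ} (hs : 1 < s.re) (z : ℍ) :
    contEis hΓ hneg hd hF σ Y i s z = eisCusp Γ (σ i) z s := by
  have hY0 : 0 < Y := by linarith
  have hmemE := memLp_eisTrunc hΓ hneg hd hF hvol hinfty hper hineq hcomplete hs i hY
  -- `Ẽ(s) = E(s)` a.e.
  have h1 : (⇑(((contEisH hΓ hneg hd hF σ Y i s : pseudoCuspSubmodule hΓ hneg hd hF σ Y) : Lp ℂ 2 (volume.restrict F))) :
      ℍ → ℂ) =ᵐ[volume.restrict F] eisTrunc Γ σ i s Y := by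
    rw [coe_contEisH_eq_eisTruncLp hΓ hneg hd hF hvol hinfty hper hineq hcomplete hY i hs]
    exact eisTruncLp_coeFn hmemE
  have h2 := (autExt_congr_ae hΓ hneg hd hF h1).trans (autExt_ae_eq_of_isAutomorphic hΓ hneg hd hF (isAutomorphic_eisTrunc hΓ i s Y))
  have h3 : contEisRep hΓ hneg hd hF σ Y i s =ᵐ[volume] fun v => eisCusp Γ (σ i) v s := by
    filter_upwards [h2] with v hv
    unfold contEisRep
    rw [hv, eisCusp_eq_eisTrunc_add_tails hΓ hd hper i hs hY0 v]
    simp_rw [contScat_eq_eisScattering hΓ hneg hd hF hvol hinfty hper hineq hcomplete hY i _ hs]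
  unfold contEis
  rw [invariantOperator_congr_ae h3 z, invariantOperator_eisCusp hΓ hd hper (stripKernel s).test i hs z, ← mul_assoc,
    inv_mul_cancel₀ (eigenvalueFn_stripKernel_ne_zero s), one_mul]

include hvol hinfty hper hineq hcomplete hY in
/-- **`E_𝔞ᵢ(·, s) = ĥ_k(s)⁻¹ L_k Ẽᵢ(·, s)` for EVERY Lipschitz test kernel with `ĥ_k(s) ≠ 0`** (at a
regular `s`) — independence of the kernel. [cite: Iwaniec2002, Thm 1.16, PDF p. 24] -/
theorem contEis_eq_invariantOperator {k : ℝ → ℝ} {L : ℝ≥0} {Bk M : ℝ} (hk : IsTestKernel k)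
    (hL : LipschitzWith L k) (hBk : ∀ u, |k u| ≤ Bk) (hM : ∀ u, M ≤ u → k u = 0) (i : Fin h) {s : ℂ}
    (hreg : IsEisRegular hΓ hneg hd hF σ Y i s) (hne : eigenvalueFn k s ≠ 0) (z : ℍ) :
    contEis hΓ hneg hd hF σ Y i s z =
      (eigenvalueFn k s)⁻¹ * invariantOperator k (contEisRep hΓ hneg hd hF σ Y i s) z := by
  rw [← invariantOperator_congr_ae (contEis_ae_eq_contEisRep hΓ hneg hd hF hvol hinfty hper hineq hcomplete hY i hreg) z,
    invariantOperator_contEis hΓ hneg hd hF hvol hinfty hper hineq hcomplete hY hk hL hBk hM i hreg z, ← mul_assoc,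
    inv_mul_cancel₀ hne, one_mul]

end Regular

/-! ## 5. Analyticity in `s` at the regular points (pointwise in `z`) -/

section Pointwise

variable (hΓ : Γ ≤ (Matrix.SpecialLinearGroup.toGL : SL(2, ℝ) →* GL (Fin 2) ℝ).range)
  (hneg : (-1 : GL (Fin 2) ℝ) ∈ Γ) (hd : IsDiscreteSubgroup Γ) (hF : IsHypFundamentalDomain Γ F)

/-- **The evaluation functional `Λ_{k,z} : L²(F) → ℂ`, `g ↦ (T_k g)(z) = (L_k g^Γ)(z)`** — bounded,
since `|L_k g^Γ(z)| ≤ B_k ∫_{B(z,R)} |g^Γ| ≤ C_z ‖g‖` (finitely many translates of `F` meet a ball).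
[cite: Iwaniec2002, §1.8 & §2.2, PDF pp. 20–21, 28–29] -/
def evalFunctional {k : ℝ → ℝ} {Bk M : ℝ} (hk : IsTestKernel k) (hkc : Continuous k) (hBk : ∀ u, |k u| ≤ Bk)
    (hM : ∀ u, M ≤ u → k u = 0) (z : ℍ) : Lp ℂ 2 (volume.restrict F) →L[ℂ] ℂ :=
  LinearMap.mkContinuous
    { toFun := fun g => kernelOp Γ F k g z
      map_add' := fun f g => by
        rw [kernelOp_congr_ae (Lp.coeFn_add f g), kernelOp_add hΓ hneg hd hF hk hkc (Lp.memLp f) (Lp.memLp g)]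
        rfl
      map_smul' := fun c g => by
        simp only [RingHom.id_apply]
        rw [kernelOp_congr_ae (Lp.coeFn_smul c g), kernelOp_smul]
        rfl }
    (Bk * (Real.sqrt ((volume (Metric.closedBall UpperHalfPlane.I (kernelRadius M + 1))).toReal) *
      Real.sqrt (orbitBoundAt Γ (dist z UpperHalfPlane.I + (kernelRadius M + 1)) / 2)))
    (by
      intro g
      simp only [LinearMap.coe_mk, AddHom.coe_mk]
      have hgl := locallyIntegrable_autExt hΓ hneg hd hF (Lp.memLp g)
      rw [kernelOp_eq_invariantOperator hΓ hneg hd hF hk (Lp.memLp g) z]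
      have h1 := norm_invariantOperator_le hBk hM hgl z
      have hBk0 : 0 ≤ Bk := (abs_nonneg _).trans (hBk 0)
      have h2 : ∫ w in Metric.closedBall z (2 * Real.arsinh (Real.sqrt M)), ‖autExt Γ F (⇑g) w‖ ≤
          ∫ w in Metric.closedBall z (kernelRadius M + 1), ‖autExt Γ F (⇑g) w‖ := by
        refine setIntegral_mono_set (hgl.integrableOn_isCompact (isCompact_closedBall _ _)).norm
          (Eventually.of_forall fun _ => norm_nonneg _) (Eventually.of_forall ?_)
        exact Metric.closedBall_subset_closedBall (by unfold kernelRadius; linarith)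
      have h3 := integral_norm_autExt_closedBall_le' hΓ hneg hd hF M (Lp.memLp g) (w := z) (D₀ := dist z UpperHalfPlane.I)
        (Metric.mem_closedBall.mpr le_rfl)
      rw [← norm_eq_sqrt_lintegral' g] at h3
      calc ‖invariantOperator k (autExt Γ F ⇑g) z‖
          ≤ Bk * ∫ w in Metric.closedBall z (kernelRadius M + 1), ‖autExt Γ F (⇑g) w‖ := h1.trans (by gcongr)
        _ ≤ Bk * (Real.sqrt ((volume (Metric.closedBall UpperHalfPlane.I (kernelRadius M + 1))).toReal) *
              Real.sqrt (orbitBoundAt Γ (dist z UpperHalfPlane.I + (kernelRadius M + 1)) / 2) * ‖g‖) := by gcongr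
        _ = _ := by ring)

/-- `Λ_{k,z} g = (T_k g)(z)`. [folklore] -/
theorem evalFunctional_apply {k : ℝ → ℝ} {Bk M : ℝ} (hk : IsTestKernel k) (hkc : Continuous k) (hBk : ∀ u, |k u| ≤ Bk)
    (hM : ∀ u, M ≤ u → k u = 0) (z : ℍ) (g : Lp ℂ 2 (volume.restrict F)) :
    evalFunctional hΓ hneg hd hF hk hkc hBk hM z g = kernelOp Γ F k g z := rfl

variable (hvol : volume F < ⊤)
  (hinfty : ∀ i, (Matrix.SpecialLinearGroup.toGL (σ i) : GL (Fin 2) ℝ) • (OnePoint.infty : OnePoint ℝ) = 𝔞 i)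
  (hper : ∀ i, (ConjAct.toConjAct (Matrix.SpecialLinearGroup.toGL (σ i) : GL (Fin 2) ℝ)⁻¹ • Γ).strictPeriods =
    AddSubgroup.zmultiples 1)
  (hineq : ∀ i j, ∀ γ ∈ Γ, γ • 𝔞 i = 𝔞 j → i = j)
  (hcomplete : ∀ c : OnePoint ℝ, IsCusp c Γ → ∃ i, ∃ γ ∈ Γ, γ • 𝔞 i = c)
  {Y : ℝ} (hY : 1 ≤ Y)

include hinfty hper hineq hY in
/-- **`L_k Ẽᵢ(·, s)(z) = Λ_{k,z}[E^Y(s)] + L_k θᵢ^s(z) + Σⱼ φᵢⱼ(s) L_k θⱼ^{1-s}(z)`.** [folklore] -/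
theorem invariantOperator_contEisRep_apply {k : ℝ → ℝ} (hk : IsTestKernel k) (i : Fin h) (s : ℂ) (z : ℍ) :
    invariantOperator k (contEisRep hΓ hneg hd hF σ Y i s) z =
      kernelOp Γ F k (⇑(((contEisH hΓ hneg hd hF σ Y i s : pseudoCuspSubmodule hΓ hneg hd hF σ Y) :
          Lp ℂ 2 (volume.restrict F)))) z +
        invariantOperator k (tailEis Γ σ i s Y) z +
        ∑ j, contScat hΓ hneg hd hF σ Y i j s * invariantOperator k (tailEis Γ σ j (1 - s) Y) z := by
  set v : Lp ℂ 2 (volume.restrict F) :=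
    ((contEisH hΓ hneg hd hF σ Y i s : pseudoCuspSubmodule hΓ hneg hd hF σ Y) : Lp ℂ 2 (volume.restrict F)) with hv
  set V : ℍ → ℂ := autExt Γ F (⇑v) with hV
  set φ : Fin h → ℂ := fun j => contScat hΓ hneg hd hF σ Y i j s with hφ
  set θ₀ : ℍ → ℂ := tailEis Γ σ i s Y with hθ₀
  set θ : Fin h → ℍ → ℂ := fun j => tailEis Γ σ j (1 - s) Y with hθ
  have hVl : LocallyIntegrable V := locallyIntegrable_autExt hΓ hneg hd hF (Lp.memLp v)
  have hθ₀l : LocallyIntegrable θ₀ := locallyIntegrable_tailEis hΓ hneg hd hinfty hper hineq i s hY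
  have hθl : ∀ j, LocallyIntegrable (θ j) := fun j => locallyIntegrable_tailEis hΓ hneg hd hinfty hper hineq j (1 - s) hY
  have e : contEisRep hΓ hneg hd hF σ Y i s = fun w => V w + θ₀ w + ∑ j, φ j * θ j w := rfl
  have hl1 : LocallyIntegrable (fun w => V w + θ₀ w) := hVl.add hθ₀l
  have hl3 : ∀ j ∈ Finset.univ, LocallyIntegrable (fun w => φ j * θ j w) := fun j _ => (hθl j).smul (φ j)
  have hl2 : LocallyIntegrable (fun w => ∑ j, φ j * θ j w) := locallyIntegrable_finsetSum Finset.univ hl3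
  have h1 : invariantOperator k (fun w => V w + θ₀ w + ∑ j, φ j * θ j w) z =
      invariantOperator k (fun w => V w + θ₀ w) z + invariantOperator k (fun w => ∑ j, φ j * θ j w) z :=
    invariantOperator_add hk hl1 hl2 z
  have h2 : invariantOperator k (fun w => V w + θ₀ w) z = invariantOperator k V z + invariantOperator k θ₀ z :=
    invariantOperator_add hk hVl hθ₀l z
  have h3 : invariantOperator k (fun w => ∑ j, φ j * θ j w) z = ∑ j, invariantOperator k (fun w => φ j * θ j w) z :=
    invariantOperator_finset_sum hk Finset.univ (f := fun j w => φ j * θ j w) hl3 z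
  have h4 : ∀ j, invariantOperator k (fun w => φ j * θ j w) z = φ j * invariantOperator k (θ j) z := fun j =>
    invariantOperator_const_mul k (φ j) (θ j) z
  rw [e, h1, h2, h3, kernelOp_eq_invariantOperator hΓ hneg hd hF hk (Lp.memLp v) z]
  congr 1
  exact Finset.sum_congr rfl fun j _ => h4 j

include hvol hinfty hper hineq hcomplete hY in
/-- **`s ↦ E_𝔞ᵢ(z, s)` is analytic at every regular point**, for each `z ∈ ℍ`: near `s`, with the fixed
kernel `k` of the strip of `s`, `E(z, s') = ĥ_k(s')⁻¹ (Λ_{k,z}[E^Y(s')] + L_kθᵢ^{s'}(z) + Σⱼ φᵢⱼ(s') L_kθⱼ^{1-s'}(z))`.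
[cite: Iwaniec2002, Thm 6.5 context, PDF p. 86] -/
theorem analyticAt_contEis_apply (i : Fin h) (z : ℍ) {s : ℂ} (hreg : IsEisRegular hΓ hneg hd hF σ Y i s) :
    AnalyticAt ℂ (fun s => contEis hΓ hneg hd hF σ Y i s z) s := by
  set κ := stripKernel s with hκ
  have hs := mem_strip_stripKernel s
  -- the good neighbourhood
  have hU1 : ∀ᶠ s' in 𝓝 s, IsEisRegular hΓ hneg hd hF σ Y i s' := (isOpen_setOf_isEisRegular hΓ hneg hd hF i).mem_nhds hreg
  have hU2 : ∀ᶠ s' in 𝓝 s, s' ∈ κ.strip := κ.isOpen_strip.mem_nhds hs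
  have hU := hU1.and hU2
  have heq : (fun s' => contEis hΓ hneg hd hF σ Y i s' z) =ᶠ[𝓝 s] fun s' => (eigenvalueFn κ.k s')⁻¹ *
      (evalFunctional hΓ hneg hd hF κ.test κ.continuous κ.bound κ.supp z
          (((contEisH hΓ hneg hd hF σ Y i s' : pseudoCuspSubmodule hΓ hneg hd hF σ Y) : Lp ℂ 2 (volume.restrict F))) +
        invariantOperator κ.k (tailEis Γ σ i s' Y) z +
        ∑ j, contScat hΓ hneg hd hF σ Y i j s' * invariantOperator κ.k (tailEis Γ σ j (1 - s') Y) z) := by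
    filter_upwards [hU] with s' hs'
    rw [contEis_eq_invariantOperator hΓ hneg hd hF hvol hinfty hper hineq hcomplete hY κ.test κ.lip κ.bound κ.supp i hs'.1
      (κ.eigenvalueFn_ne_zero hs'.2) z, invariantOperator_contEisRep_apply hΓ hneg hd hF hinfty hper hineq hY κ.test i s' z,
      evalFunctional_apply]
  refine (analyticAt_congr heq).mpr ?_
  have hv : AnalyticAt ℂ (fun s' => ((contEisH hΓ hneg hd hF σ Y i s' : pseudoCuspSubmodule hΓ hneg hd hF σ Y) :
      Lp ℂ 2 (volume.restrict F))) s :=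
    ((pseudoCuspSubmodule hΓ hneg hd hF σ Y).subtypeL).comp_analyticAt' hreg.1
  refine ((κ.analyticAt_eigenvalueFn s).inv (κ.eigenvalueFn_ne_zero hs)).mul ?_
  refine (((evalFunctional hΓ hneg hd hF κ.test κ.continuous κ.bound κ.supp z).comp_analyticAt' hv).add
    ((differentiable_invariantOperator_tailEis_apply hΓ hneg hd hinfty hper hineq κ.test κ.supp i hY z).analyticAt s)).add ?_
  refine Finset.analyticAt_fun_sum Finset.univ fun j _ => (hreg.2 j).mul ?_
  exact ((differentiable_invariantOperator_tailEis_apply hΓ hneg hd hinfty hper hineq κ.test κ.supp j hY z).analyticAt (1 - s)).comp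
    (analyticAt_const.sub analyticAt_id)

include hvol hinfty hper hineq hcomplete hY in
/-- `s ↦ E_𝔞ᵢ(z, s)` is continuous at every regular point. [folklore] -/
theorem continuousAt_contEis_apply (i : Fin h) (z : ℍ) {s : ℂ} (hreg : IsEisRegular hΓ hneg hd hF σ Y i s) :
    ContinuousAt (fun s => contEis hΓ hneg hd hF σ Y i s z) s :=
  (analyticAt_contEis_apply hΓ hneg hd hF hvol hinfty hper hineq hcomplete hY i z hreg).continuousAt

end Pointwise

end Fuchsian

end Literature.NumberTheory.Automorphic
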